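import Literature.NumberTheory.PAdicHodge.BmaxPlusKerTheta
import Literature.NumberTheory.PAdicHodge.BdRPlusDVR
import HarnessLib

/-!
# `ω' = ξ/p + 1` is a non-zero-divisor modulo every `pⁿ` on `A_max`: `(ξ/p + 1)·A_max ∩ pⁿA_max = pⁿ·(ξ/p + 1)·A_max`

Topic `Literature/NumberTheory/PAdicHodge`; namespace `Literature.NumberTheory.PAdicHodge`. THEOREMS ONLY (no definition, no named
fact, no instance). Continuation of `BmaxPlusKerTheta` on Colmez's `A_max = B_max⁺(F)` (`BmaxPlus`, `p`-adic completion of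
`B⁰_max = 𝔸_inf[ξ/p]`, `T = ξ/p = omegaB`, `ω' = T + 1 = [p♭]/p`). In the polynomial ring `B⁰_max/p = (𝒪_{ℂ_F}♭/p♭)[T]`
(`BmaxPlusKerTheta`) the element `ω' = T + 1` is monic, hence a non-zero-divisor:

* `mem_span_of_omegaB_add_one_mul_mem` / `mem_span_pow_of_omegaB_add_one_mul_mem` — **`(ξ/p + 1)·y ∈ pⁿB⁰_max ⇒ y ∈ pⁿB⁰_max`**;
* ★ `exists_eq_natCast_pow_mul_of_omegaB_add_one_mul_eq` — **`(ξ/p + 1)·G ∈ pᵏ·A_max ⇒ G ∈ pᵏ·A_max`** on the completion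
  (`x ∈ pᵏA_max ⇔ x mod pᵏ = 0`, tree `PrincipalCompletion.evalₐ_eq_zero_iff`).

(`ω'` is NOT a unit of `A_max` — `θ(ω') = 1` but `A_max/ω'A_max ≅ 𝔸_inf/[p♭]` — so this saturation is the usable substitute.) Step (ω'-sat) of the
`t`-divisibility theorem (TDIV) for `(A_max)^{φ=p} ∩ ker θ` (brick B7 of the φ-road of line `kato_lever`, crux K★ `stmt-BirchSwinnertonDyer-22226`,
memo `Cruxes/StarredOptimalManinUnitFiveSeven/Lines/kato-lever-K2-fontaine-lemma-g24.md`). Infrastructure only: BSD / K★ are not proved by this.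

## References
* [Colmez1998Annals] P. Colmez, *Théorie d'Iwasawa des représentations de de Rham d'un corps local*, Ann. of Math. 148 (1998), §III.2.
* [BergerLaurent2002] L. Berger, *Représentations p-adiques et équations différentielles*, Invent. Math. 148 (2002), §1.2.
-/

noncomputable section

open WittVector Field ValuativeRel Polynomial Finset
open Literature.AlgebraicGeometry.Resolution

namespace Literature.NumberTheory.PAdicHodge

open Literature.NumberTheory.GaloisRepresentations
open Literature.NumberTheory.GaloisRepresentations.IsNonarchimedeanLocalField

variable {F : Type} [Field F] [ValuativeRel F] [TopologicalSpace F] [IsNonarchimedeanLocalField F]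
  [CharZero F] {p : ℕ} [Fact p.Prime] [Fact (¬ IsUnit (p : integerC F))]
  [IsAdicComplete (Ideal.span {(p : integerC F)}) (integerC F)]

/-! ### `ξ/p + 1` is a non-zero-divisor on `B⁰_max/p` -/

omit [CharZero F] [IsAdicComplete (Ideal.span {(p : integerC F)}) (integerC F)] in
/-- Membership in `𝔞·𝔸_inf[X]` is vanishing of the reduction modulo `𝔞`. [folklore] -/
private theorem mem_map_C_iff_map_mk_eq_zero (𝔞 : Ideal (Ainf (p := p) F)) (f : (Ainf (p := p) F)[X]) :
    f ∈ 𝔞.map C ↔ Polynomial.map (Ideal.Quotient.mk 𝔞) f = 0 := by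
  rw [Ideal.mem_map_C_iff, Polynomial.ext_iff]
  refine forall_congr' fun n => ?_
  rw [coeff_map, coeff_zero, Ideal.Quotient.eq_zero_iff_mem]

/-- **`(ξ/p + 1)·y ∈ p·B⁰_max ⇒ y ∈ p·B⁰_max`**: `T + 1` is monic, hence a non-zero-divisor in the polynomial ring `B⁰_max/p = (𝔸_inf/(p,ξ))[T]`.
[cite: Colmez1998Annals, §III.2] -/
theorem mem_span_of_omegaB_add_one_mul_mem {y : bmaxZero F p} (hy : (omegaB + 1) * y ∈ Ideal.span {(p : bmaxZero F p)}) :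
    y ∈ Ideal.span {(p : bmaxZero F p)} := by
  obtain ⟨q, rfl⟩ := exists_aeval_omegaB_eq y
  have h1 : aeval (omegaB : bmaxZero F p) ((X + C 1) * q) ∈ Ideal.span {(p : bmaxZero F p)} := by
    rwa [map_mul, map_add, aeval_X, aeval_C, map_one]
  have h2 := mem_map_C_of_aeval_omegaB_mem_span h1
  refine aeval_omegaB_mem_span_of_mem_map_C ?_
  rw [mem_map_C_iff_map_mk_eq_zero] at h2 ⊢
  rw [Polynomial.map_mul, Polynomial.map_add, Polynomial.map_X, Polynomial.map_C, map_one] at h2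
  exact (monic_X_add_C (1 : Ainf (p := p) F ⧸ Ideal.span {(p : Ainf (p := p) F), xi})).mul_right_eq_zero_iff.1 h2

/-- **`(ξ/p + 1)·y ∈ pⁿ·B⁰_max ⇒ y ∈ pⁿ·B⁰_max`.** [cite: Colmez1998Annals, §III.2] -/
theorem mem_span_pow_of_omegaB_add_one_mul_mem (n : ℕ) :
    ∀ {y : bmaxZero F p}, (omegaB + 1) * y ∈ Ideal.span {(p : bmaxZero F p)} ^ n → y ∈ Ideal.span {(p : bmaxZero F p)} ^ n := by
  induction n with
  | zero => intro y _; rw [pow_zero, Ideal.one_eq_top]; exact Submodule.mem_top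
  | succ n ih =>
    intro y hy
    have hy1 : (omegaB + 1) * y ∈ Ideal.span {(p : bmaxZero F p)} :=
      Ideal.pow_le_self (I := Ideal.span {(p : bmaxZero F p)}) (Nat.succ_ne_zero n) hy
    have hy2 := mem_span_of_omegaB_add_one_mul_mem hy1
    rw [Ideal.mem_span_singleton'] at hy2
    obtain ⟨y', rfl⟩ := hy2
    have hy3 := hy
    rw [Ideal.span_singleton_pow, Ideal.mem_span_singleton'] at hy3
    obtain ⟨w, hw⟩ := hy3
    have h4 : (omegaB + 1) * y' ∈ Ideal.span {(p : bmaxZero F p)} ^ n := by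
      rw [Ideal.span_singleton_pow, Ideal.mem_span_singleton']
      refine ⟨w, eq_of_natCast_pow_mul_eq (p := p) (F := F) (v := 1) ?_⟩
      rw [pow_one]
      linear_combination hw
    have h5 := ih h4
    rw [Ideal.span_singleton_pow, Ideal.mem_span_singleton'] at h5
    obtain ⟨w', hw'⟩ := h5
    rw [Ideal.span_singleton_pow, Ideal.mem_span_singleton']
    exact ⟨w', by rw [pow_succ, ← mul_assoc, hw']⟩

/-! ### On the completion `A_max` -/

set_option maxHeartbeats 1600000 in
set_option synthInstance.maxHeartbeats 400000 in
/-- ★ **`(ξ/p + 1)·G ∈ pᵏ·A_max ⇒ G ∈ pᵏ·A_max`**: if `(ξ/p + 1)·G = pᵏ·H` in `A_max = B_max⁺(F)` then `G = pᵏ·G'` for some `G'`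
(`x ∈ pᵏA_max` iff `x mod pᵏ = 0`, and `ξ/p + 1` is a non-zero-divisor mod `pᵏ`). [cite: Colmez1998Annals, §III.2] -/
theorem exists_eq_natCast_pow_mul_of_omegaB_add_one_mul_eq {k : ℕ} {G H : BmaxPlus F p}
    (h : (algebraMap (bmaxZero F p) (BmaxPlus F p) omegaB + 1) * G = (p : BmaxPlus F p) ^ k * H) :
    ∃ G' : BmaxPlus F p, G = (p : BmaxPlus F p) ^ k * G' := by
  have hp : PrincipalCompletion.xiHat (Ideal.span {(p : bmaxZero F p)}) (p : bmaxZero F p) = (p : BmaxPlus F p) :=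
    map_natCast (algebraMap (bmaxZero F p) (BmaxPlus F p)) p
  have key := (PrincipalCompletion.evalₐ_eq_zero_iff (I := Ideal.span {(p : bmaxZero F p)}) rfl G k)
  rw [hp] at key
  refine key.1 ?_
  obtain ⟨y, hy⟩ := Ideal.Quotient.mk_surjective (AdicCompletion.evalₐ (Ideal.span {(p : bmaxZero F p)}) k G)
  obtain ⟨z, hz⟩ := Ideal.Quotient.mk_surjective (AdicCompletion.evalₐ (Ideal.span {(p : bmaxZero F p)}) k H)
  have e0 : AdicCompletion.evalₐ (Ideal.span {(p : bmaxZero F p)}) k (algebraMap (bmaxZero F p) (BmaxPlus F p) omegaB) =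
      Ideal.Quotient.mk _ omegaB := AdicCompletion.evalₐ_of _ k _
  have h' := congrArg (AdicCompletion.evalₐ (Ideal.span {(p : bmaxZero F p)}) k) h
  simp only [map_mul, map_add, map_one, map_pow, map_natCast, e0, ← hy, ← hz] at h'
  -- `h' : (mk ω + 1) * mk y = p^k * mk z` in `B⁰_max/p^k`
  have e3 : Ideal.Quotient.mk (Ideal.span {(p : bmaxZero F p)} ^ k) ((omegaB + 1) * y) =
      Ideal.Quotient.mk (Ideal.span {(p : bmaxZero F p)} ^ k) ((p : bmaxZero F p) ^ k * z) := by
    simp only [map_mul, map_add, map_one, map_pow, map_natCast]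
    exact h'
  rw [Ideal.Quotient.eq] at e3
  have e4 : (omegaB + 1) * y ∈ Ideal.span {(p : bmaxZero F p)} ^ k := by
    have h5 : (p : bmaxZero F p) ^ k * z ∈ Ideal.span {(p : bmaxZero F p)} ^ k := by
      rw [Ideal.span_singleton_pow]; exact Ideal.mul_mem_right _ _ (Ideal.mem_span_singleton_self _)
    have e : (omegaB + 1) * y = ((omegaB + 1) * y - (p : bmaxZero F p) ^ k * z) + (p : bmaxZero F p) ^ k * z := by ring
    rw [e]; exact add_mem e3 h5
  rw [← hy, Ideal.Quotient.eq_zero_iff_mem]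
  exact mem_span_pow_of_omegaB_add_one_mul_mem k e4

end Literature.NumberTheory.PAdicHodge

end
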